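import Literature.AlgebraicGeometry.Limits.LocalizationDiagram
import HarnessLib

/-!
# Limits of schemes: `P ×_A Spec A_S = lim_s P ×_A Spec A[1/s]`, and spreading out of morphisms

Topic: `Literature/AlgebraicGeometry/Limits`; sequel of `Limits/LocalizationDiagram` (`A` a
commutative ring, `S ⊆ A` a submonoid, `B` a localization of `A` at `S`, `Spec B = lim_s Spec A[1/s]`
over the cofiltered category `LocApprox.Idx S`), copying the architecture of
`Limits/SubalgebraDiagram`. For an `A`-scheme `P` (an object of `Over (Spec A)` with its cartesian
monoidal structure `P ⊗ T = P ×_A T`):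

* `prodDiagram P = baseDiagram ⋙ tensorLeft P ⋙ Over.forget`, `prodCone`, **`isLimitProdCone`** —
  `(P ⊗ Spec B).left = lim_s (P ⊗ Spec A[1/s]).left` in `Scheme` (directly from the universal
  property of the fibre product; Görtz–Wedhorn I, (10.13): "`X ×_{S₀} S` is the limit of the
  `X ×_{S₀} S_λ`"), with the `rfl`-API, affineness / open-immersion of the transition maps and
  quasi-compactness / quasi-separatedness of the stages (instances, via the general base-change
  lemmas `SubalgApprox.isAffineHom_whiskerLeft_left` etc. of `Limits/SubalgebraDiagram`) — the
  hypotheses of Mathlib's `Mathlib.AlgebraicGeometry.AffineTransitionLimit` (Stacks 01YT);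
* **`exists_whiskerLeft_comp_eq`** — surjectivity half of Stacks 01ZC in this setting: an
  `A`-morphism `P ⊗ Spec B → X`, `P` qcqs and `X` locally of finite presentation over `A`, is the
  restriction of an `A`-morphism `P ⊗ Spec A[1/s] → X` for some `s ∈ S`
  (Mathlib `Scheme.exists_π_app_comp_eq_of_locallyOfFinitePresentation`);
* **`exists_whiskerLeft_map_comp_eq`** — injectivity half: two `A`-morphisms `P ⊗ Spec A[1/s] → X`,
  `P` quasi-compact and `X` locally of finite type over `A`, which agree on `P ⊗ Spec B` agree on
  `P ⊗ Spec A[1/t]` for some `t ∈ S`, `s ∣ t`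
  (Mathlib `Scheme.exists_hom_comp_eq_comp_of_locallyOfFiniteType`).

With `S = A ∖ 𝔭` (`B = A_𝔭`) these are the "spread out from the local ring to an open
neighbourhood `D(s) ∋ 𝔭`" statements; with `S = A ∖ {0}` for a domain (`B = Frac A`) the "spread
out from the generic fibre" statements (EGA IV₃ 8.8.2 (i)). Consumer in this tree: the existence
programme for Néron models (`Literature.NumberTheory.EllipticCurves.NeronModel*`).

## References

* The Stacks project, Tags 01YT, 01ZC. [StacksProject]
* A. Grothendieck, EGA IV₃, §8.2 and Thm. 8.8.2 (Publ. Math. IHÉS 28, 1966). [EGAIV3]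
* U. Görtz, T. Wedhorn, *Algebraic Geometry I: Schemes*, 2nd ed. (2020), (10.13) and Thm. 10.57,
  pp. 321–327. [GortzWedhorn2020]
-/

noncomputable section

universe u

open CategoryTheory CategoryTheory.Limits AlgebraicGeometry TopologicalSpace MonoidalCategory
open Opposite

namespace Literature.AlgebraicGeometry.Limits

namespace LocApprox

open Literature.AlgebraicGeometry.Motives (SchemeOver specOver)

set_option backward.isDefEq.respectTransparency false

variable {A : Type u} [CommRing A] (S : Submonoid A) (B : Type u) [CommRing B] [Algebra A B]
  [IsLocalization S B]

/-! ## The diagram `s ↦ (P ⊗ Spec A[1/s]).left` and its limit `(P ⊗ Spec B).left` -/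

variable (P : SchemeOver A)

/-- The cofiltered diagram `s ↦ P ×_A Spec A[1/s] = (P ⊗ Spec A[1/s]).left` of schemes (the
open subschemes `P|_{D(s)}` of `P`, `s ∈ S`). [folklore] -/
def prodDiagram : Idx S ⥤ Scheme.{u} :=
  baseDiagram S ⋙ tensorLeft P ⋙ Over.forget _

/-- The cone `(P ⊗ Spec B).left → (P ⊗ Spec A[1/s]).left`. [folklore] -/
def prodCone : Cone (prodDiagram S P) :=
  (tensorLeft P ⋙ Over.forget _).mapCone (baseCone S B)

/-- The objects of `prodDiagram` (by `rfl`). [folklore] -/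
theorem prodDiagram_obj (s : Idx S) :
    (prodDiagram S P).obj s = (P ⊗ (baseDiagram S).obj s).left := rfl

/-- The objects of `prodDiagram` are the fibre products `P ×_A Spec A[1/s]` (by `rfl`).
[folklore] -/
theorem prodDiagram_obj' (s : Idx S) :
    (prodDiagram S P).obj s =
      pullback P.hom (Spec.map (CommRingCat.ofHom (algebraMap A (loc S s)))) := rfl

/-- The transition maps of `prodDiagram` (by `rfl`). [folklore] -/
theorem prodDiagram_map {t s : Idx S} (f : t ⟶ s) :
    (prodDiagram S P).map f = (P ◁ (baseDiagram S).map f).left := rfl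

/-- The cone point of `prodCone` (by `rfl`). [folklore] -/
theorem prodCone_pt : (prodCone S B P).pt = (P ⊗ specOver A B).left := rfl

/-- The cone point of `prodCone` is the fibre product `P ×_A Spec B` (by `rfl`). [folklore] -/
theorem prodCone_pt' :
    (prodCone S B P).pt = pullback P.hom (Spec.map (CommRingCat.ofHom (algebraMap A B))) := rfl

/-- The legs of `prodCone` (by `rfl`). [folklore] -/
theorem prodCone_π_app (s : Idx S) :
    (prodCone S B P).π.app s = (P ◁ (baseCone S B).π.app s).left := rfl

/-- The transition maps commute with the first projections. [folklore] -/
@[reassoc]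
theorem prodDiagram_map_fst {t s : Idx S} (f : t ⟶ s) :
    (prodDiagram S P).map f ≫ pullback.fst _ _ = pullback.fst _ _ :=
  Over.whiskerLeft_left_fst _

/-- The transition maps commute with the second projections. [folklore] -/
@[reassoc]
theorem prodDiagram_map_snd {t s : Idx S} (f : t ⟶ s) :
    (prodDiagram S P).map f ≫ pullback.snd _ _ =
      pullback.snd _ _ ≫ ((baseDiagram S).map f).left :=
  Over.whiskerLeft_left_snd _

/-- The legs commute with the first projections. [folklore] -/
@[reassoc]
theorem prodCone_π_app_fst (s : Idx S) :
    (prodCone S B P).π.app s ≫ pullback.fst _ _ = pullback.fst _ _ :=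
  Over.whiskerLeft_left_fst _

/-- The legs commute with the second projections. [folklore] -/
@[reassoc]
theorem prodCone_π_app_snd (s : Idx S) :
    (prodCone S B P).π.app s ≫ pullback.snd _ _ =
      pullback.snd _ _ ≫ ((baseCone S B).π.app s).left :=
  Over.whiskerLeft_left_snd _

/-- The transition maps are affine. [folklore] -/
instance isAffineHom_prodDiagram_map {t s : Idx S} (f : t ⟶ s) :
    IsAffineHom ((prodDiagram S P).map f) := by
  rw [prodDiagram_map]
  infer_instance

/-- The transition maps are open immersions. [folklore] -/
instance isOpenImmersion_prodDiagram_map {t s : Idx S} (f : t ⟶ s) :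
    IsOpenImmersion ((prodDiagram S P).map f) := by
  rw [prodDiagram_map]
  infer_instance

/-- For `P` quasi-compact over `A`, the objects are quasi-compact. [folklore] -/
instance compactSpace_prodDiagram_obj [QuasiCompact P.hom] (s : Idx S) :
    CompactSpace ((prodDiagram S P).obj s) := by
  rw [prodDiagram_obj]
  infer_instance

/-- For `P` quasi-separated over `A`, the objects are quasi-separated. [folklore] -/
instance quasiSeparatedSpace_prodDiagram_obj [QuasiSeparated P.hom] (s : Idx S) :
    QuasiSeparatedSpace ((prodDiagram S P).obj s) := by
  rw [prodDiagram_obj]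
  infer_instance

/-! ### `prodCone` is a limit cone -/

variable {S B P}

/-- All legs of a cone over `prodDiagram` have the same first component. [folklore] -/
theorem cone_π_app_fst_eq (c : Cone (prodDiagram S P)) (s t : Idx S) :
    c.π.app s ≫ pullback.fst _ _ = c.π.app t ≫ pullback.fst _ _ := by
  obtain ⟨r, ⟨f⟩, ⟨f'⟩⟩ := exists_hom₂ S s t
  rw [← c.w f, ← c.w f', Category.assoc, Category.assoc, prodDiagram_map_fst,
    prodDiagram_map_fst]

/-- The second components of the legs of a cone over `prodDiagram` form a cone over the
`Spec A[1/s]`. [folklore] -/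
def sndCone (c : Cone (prodDiagram S P)) : Cone (baseDiagram S ⋙ Over.forget _) where
  pt := c.pt
  π := { app s := c.π.app s ≫ pullback.snd _ _
         naturality t s f := by
           change 𝟙 _ ≫ c.π.app s ≫ pullback.snd _ _ =
             (c.π.app t ≫ pullback.snd _ _) ≫ ((baseDiagram S).map f).left
           rw [Category.id_comp, ← c.w f, Category.assoc, Category.assoc, prodDiagram_map_snd] }

variable (B) in
/-- The induced morphism to `Spec B` is compatible with the legs. [folklore] -/
@[reassoc]
theorem lift_sndCone_π (c : Cone (prodDiagram S P)) (s : Idx S) :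
    (isLimitForgetBaseCone S B).lift (sndCone c) ≫ ((baseCone S B).π.app s).left =
      c.π.app s ≫ pullback.snd _ _ :=
  (isLimitForgetBaseCone S B).fac (sndCone c) s

/-- The (common) first component of the legs of a cone over `prodDiagram`. [folklore] -/
def fstComp (c : Cone (prodDiagram S P)) : c.pt ⟶ P.left :=
  c.π.app default ≫ pullback.fst _ _

/-- `fstComp` is the first component of every leg. [folklore] -/
theorem fstComp_eq (c : Cone (prodDiagram S P)) (s : Idx S) :
    fstComp c = c.π.app s ≫ pullback.fst _ _ :=
  cone_π_app_fst_eq c _ _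

variable (B) in
/-- The two components of a cone over `prodDiagram` agree over `Spec A`. [folklore] -/
theorem fstComp_comp_hom (c : Cone (prodDiagram S P)) :
    fstComp c ≫ P.hom =
      (isLimitForgetBaseCone S B).lift (sndCone c) ≫ (baseCone S B).pt.hom := by
  have h1 : fstComp c ≫ P.hom =
      (c.π.app default ≫ pullback.snd _ _) ≫ ((baseDiagram S).obj default).hom := by
    rw [fstComp, Category.assoc, pullback.condition, Category.assoc]
  rw [h1, ← lift_sndCone_π B, Category.assoc]
  change _ ≫ _ ≫ Spec.map ((baseNat S).app (op default)) =
    _ ≫ Spec.map (CommRingCat.ofHom (algebraMap A B))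
  rw [← baseNat_ι S B (op default), Spec.map_comp]
  rfl

variable (B) in
/-- The lift of a cone over `prodDiagram` to `(P ⊗ Spec B).left`. [folklore] -/
def prodLift (c : Cone (prodDiagram S P)) : c.pt ⟶ (prodCone S B P).pt :=
  pullback.lift (fstComp c) ((isLimitForgetBaseCone S B).lift (sndCone c)) (fstComp_comp_hom B c)

variable (S B P) in
/-- **`(P ⊗ Spec A_S).left` is the limit of the open subschemes `(P ⊗ Spec A[1/s]).left`,
`s ∈ S`** (fibre products commute with cofiltered limits; the setting of Stacks 01YT /
EGA IV₃ §8 for the localization `A_S = colim A[1/s]`). [folklore] -/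
def isLimitProdCone : IsLimit (prodCone S B P) where
  lift c := prodLift B c
  fac c s := by
    apply pullback.hom_ext
    · rw [Category.assoc, prodCone_π_app_fst, prodLift, pullback.lift_fst]
      exact fstComp_eq c s
    · rw [Category.assoc, prodCone_π_app_snd, prodLift, pullback.lift_snd_assoc]
      exact lift_sndCone_π B c s
  uniq c m hm := by
    apply pullback.hom_ext
    · rw [prodLift, pullback.lift_fst, fstComp_eq c default, ← hm default, Category.assoc,
        prodCone_π_app_fst]
    · rw [prodLift, pullback.lift_snd]
      refine (isLimitForgetBaseCone S B).uniq (sndCone c) _ fun s => ?_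
      change (m ≫ pullback.snd _ _) ≫ ((baseCone S B).π.app s).left = c.π.app s ≫ pullback.snd _ _
      rw [Category.assoc, ← prodCone_π_app_snd, ← Category.assoc, hm s]

/-! ## Spreading out morphisms from `P ⊗ Spec A_S` to a stage `P ⊗ Spec A[1/s]` -/

variable (S P) in
/-- The structure maps `(P ⊗ Spec A[1/s]).left → Spec A`, as a natural transformation to the
constant diagram. [folklore] -/
def prodNat : prodDiagram S P ⟶ (Functor.const (Idx S)).obj (Spec (CommRingCat.of A)) where
  app s := (P ⊗ (baseDiagram S).obj s).hom
  naturality t s f := by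
    change (P ◁ (baseDiagram S).map f).left ≫ (P ⊗ (baseDiagram S).obj s).hom =
      (P ⊗ (baseDiagram S).obj t).hom ≫ 𝟙 _
    rw [Over.w]
    exact (Category.comp_id _).symm

/-- The components of `prodNat` (by `rfl`). [folklore] -/
theorem prodNat_app (s : Idx S) : (prodNat S P).app s = (P ⊗ (baseDiagram S).obj s).hom := rfl

variable (B) in
/-- **Surjectivity half of Stacks 01ZC for the localization diagram.** Let `P → Spec A` be
quasi-compact and quasi-separated and `X → Spec A` locally of finite presentation. Every
`A`-morphism `P ×_A Spec A_S → X` is the restriction of an `A`-morphism `P ×_A Spec A[1/s] → X`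
for some `s ∈ S` (Mathlib `Scheme.exists_π_app_comp_eq_of_locallyOfFinitePresentation` applied
to `isLimitProdCone`). [folklore] -/
theorem exists_whiskerLeft_comp_eq [QuasiCompact P.hom] [QuasiSeparated P.hom] {X : SchemeOver A}
    [LocallyOfFinitePresentation X.hom] (a : P ⊗ specOver A B ⟶ X) :
    ∃ (s : Idx S) (g : P ⊗ (baseDiagram S).obj s ⟶ X),
      (P ◁ (baseCone S B).π.app s) ≫ g = a := by
  have ha : (prodCone S B P).π ≫ prodNat S P =
      (Functor.const (Idx S)).map (a.left ≫ X.hom) := by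
    ext s
    change (P ◁ (baseCone S B).π.app s).left ≫ (P ⊗ (baseDiagram S).obj s).hom = a.left ≫ X.hom
    rw [Over.w, Over.w]
    rfl
  obtain ⟨s, g, hg, hg'⟩ := Scheme.exists_π_app_comp_eq_of_locallyOfFinitePresentation
    (prodDiagram S P) (prodNat S P) X.hom (prodCone S B P) (isLimitProdCone S B P) a.left ha
  refine ⟨s, Over.homMk g hg', ?_⟩
  ext : 1
  exact hg

variable (B) in
/-- **Injectivity half of Stacks 01ZC for the localization diagram.** Let `P → Spec A` be
quasi-compact and `X → Spec A` locally of finite type. Two `A`-morphisms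
`P ×_A Spec A[1/s] → X` which agree on `P ×_A Spec A_S` agree on `P ×_A Spec A[1/t]` for some
`t ∈ S` with `s ∣ t` (Mathlib `Scheme.exists_hom_comp_eq_comp_of_locallyOfFiniteType` applied
to `isLimitProdCone`). [folklore] -/
theorem exists_whiskerLeft_map_comp_eq [QuasiCompact P.hom] {X : SchemeOver A}
    [LocallyOfFiniteType X.hom] {s : Idx S} (g₁ g₂ : P ⊗ (baseDiagram S).obj s ⟶ X)
    (h : (P ◁ (baseCone S B).π.app s) ≫ g₁ = (P ◁ (baseCone S B).π.app s) ≫ g₂) :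
    ∃ (t : Idx S) (f : t ⟶ s),
      (P ◁ (baseDiagram S).map f) ≫ g₁ = (P ◁ (baseDiagram S).map f) ≫ g₂ := by
  obtain ⟨t, f, e⟩ := Scheme.exists_hom_comp_eq_comp_of_locallyOfFiniteType
    (prodDiagram S P) (prodNat S P) X.hom (prodCone S B P) (isLimitProdCone S B P) (i := s)
    g₁.left g₂.left (Over.w g₁).symm (Over.w g₂).symm (congrArg CommaMorphism.left h)
  refine ⟨t, f, ?_⟩
  ext : 1
  exact e

end LocApprox

end Literature.AlgebraicGeometry.Limits

end
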